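import Summits.AnomalousDissipation.AnomalousDissipation.Theorems.SoloBlindEnergyFloorKolmogorov

/-!
# Solo (blind) — the Kolmogorov energy floor with the two-mode Chebyshev multiplier

`Theorems/SoloBlindEnergyFloorKolmogorov` tested the momentum balance of `NS_ν(cos(2πx₃)e₁)`
against the force itself and obtained the floor `meanEnergy ≥ 1/(2π) ≈ 0.159` for every
vanishing-viscosity family of global Leray–Hopf solutions with bounded mean energy. The optimum
over shear multipliers `Ψ = φ(x₃)e₁` is the (non-smooth) sawtooth, value `2/π² ≈ 0.203`
(Doering–Eckhardt–Schumacher 2003, Lemma 2). Here the multiplier is the smooth two-mode shear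

  `Ψ(x) = (cos(2πx₃)/(3π) + cos(6πx₃)/(54π)) e₁`,  `∂₃Ψ₁ = −(⅔ sin 2πx₃ + ⅑ sin 6πx₃) = −p(sin 2πx₃)`,
  `p(s) = s − (4/9)s³ = T₃(s/√3)·(−1/√3)`-type Chebyshev economisation, `1 − 3p(s)² = (1 − s²/3)(1 − 4s²/3)²`,

so `|∂₃Ψ₁| ≤ 1/√3` pointwise while `∫⟪f,Ψ⟫ = 1/(6π)`; the semidefinite constant is `c = √3/6` and
the floor becomes (`kolmogorov_energyBound_ge_chebyshev`)

  `meanEnergy (u j) ≤ E` for all `j` ⟹ `E ≥ 1/(π√3) ≈ 0.184`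

(90.7 % of the sawtooth value; no hypothesis on data, uniqueness, regularity or energy equality).
Everything is evaluated inside the `realTrigPoly` calculus: the only new ingredient is the
POINTWISE evaluation of a trigonometric polynomial in `x₃` through `e_{e₃}(x) = fourier 1 (x₃)`.
[cite: DoeringFoias2002, §3] [cite: DoeringEckhardtSchumacher2003, Lemma 2]
-/

open MeasureTheory Filter Topology Set UnitAddTorus
open scoped ENNReal NNReal InnerProductSpace ComplexConjugate

noncomputable section

namespace Summit.AnomalousDissipation.AnomalousDissipation.Theorems

open Literature.Analysis.FunctionSpaces Literature.Analysis.FunctionSpaces.Torus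
open Literature.Analysis.FluidPDE

/-! ### The modes `±e₃, ±3e₃` -/

/-- The third harmonic `3e₃ ∈ ℤ³`. [folklore] -/
def chebFreq : Fin 3 → ℤ := ![0, 0, 3]

/-- `3e₃ = e₃ + (e₃ + e₃)`. [folklore] -/
theorem chebFreq_eq : chebFreq = kolFreq + (kolFreq + kolFreq) := by
  funext i
  fin_cases i <;> simp [chebFreq, kolFreq]

/-- `e₃ = Pi.single 2 1`. [folklore] -/
theorem kolFreq_eq_single : kolFreq = Pi.single (2 : Fin 3) (1 : ℤ) := by
  funext i
  fin_cases i <;> simp [kolFreq]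

/-- `(e₃)₃ = 1`. [folklore] -/
@[simp] theorem kolFreq_apply_two : kolFreq 2 = 1 := by simp [kolFreq]
/-- `(3e₃)₃ = 3`. [folklore] -/
@[simp] theorem chebFreq_apply_two : chebFreq 2 = 3 := by simp [chebFreq]
/-- `(3e₃)₁ = 0`. [folklore] -/
@[simp] theorem chebFreq_apply_zero : chebFreq 0 = 0 := by simp [chebFreq]
/-- `(3e₃)₂ = 0`. [folklore] -/
@[simp] theorem chebFreq_apply_one : chebFreq 1 = 0 := by simp [chebFreq]

/-- `e₃ ≠ 3e₃`. [folklore] -/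
theorem kolFreq_ne_chebFreq : kolFreq ≠ chebFreq := fun h => by
  simpa [kolFreq, chebFreq] using congrFun h 2
/-- `e₃ ≠ -3e₃`. [folklore] -/
theorem kolFreq_ne_neg_chebFreq : kolFreq ≠ -chebFreq := fun h => by
  simpa [kolFreq, chebFreq] using congrFun h 2
/-- `-e₃ ≠ 3e₃`. [folklore] -/
theorem neg_kolFreq_ne_chebFreq : -kolFreq ≠ chebFreq := fun h => by
  simpa [kolFreq, chebFreq] using congrFun h 2
/-- `-e₃ ≠ -3e₃`. [folklore] -/
theorem neg_kolFreq_ne_neg_chebFreq : -kolFreq ≠ -chebFreq := fun h => by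
  simpa [kolFreq, chebFreq] using congrFun h 2
/-- `3e₃ ≠ -3e₃`. [folklore] -/
theorem chebFreq_ne_neg_chebFreq : chebFreq ≠ -chebFreq := fun h => by
  simpa [chebFreq] using congrFun h 2

/-- `3e₃ ∉ {e₃, -e₃}`. [folklore] -/
theorem chebFreq_not_mem_kolModes : chebFreq ∉ kolModes := fun h => by
  rcases mem_kolModes_iff.1 h with h | h
  · exact kolFreq_ne_chebFreq h.symm
  · exact neg_kolFreq_ne_chebFreq h.symm

/-- `-3e₃ ∉ {e₃, -e₃}`. [folklore] -/
theorem neg_chebFreq_not_mem_kolModes : -chebFreq ∉ kolModes := fun h => by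
  rcases mem_kolModes_iff.1 h with h | h
  · exact kolFreq_ne_neg_chebFreq h.symm
  · exact neg_kolFreq_ne_neg_chebFreq h.symm

/-- The four-mode shell `{e₃, -e₃, 3e₃, -3e₃}`. [folklore] -/
def chebModes : Finset (Fin 3 → ℤ) := {kolFreq, -kolFreq, chebFreq, -chebFreq}

/-- Membership in the shell. [folklore] -/
theorem mem_chebModes_iff {k : Fin 3 → ℤ} :
    k ∈ chebModes ↔ k = kolFreq ∨ k = -kolFreq ∨ k = chebFreq ∨ k = -chebFreq := by
  simp [chebModes]

/-- Sums over the shell. [folklore] -/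
theorem sum_chebModes {M : Type*} [AddCommMonoid M] (g : (Fin 3 → ℤ) → M) :
    ∑ k ∈ chebModes, g k = g kolFreq + g (-kolFreq) + (g chebFreq + g (-chebFreq)) := by
  rw [chebModes, Finset.sum_insert, Finset.sum_insert, Finset.sum_pair chebFreq_ne_neg_chebFreq,
    add_assoc]
  all_goals simp only [Finset.mem_insert, Finset.mem_singleton, not_or]
  · exact ⟨neg_kolFreq_ne_chebFreq, neg_kolFreq_ne_neg_chebFreq⟩
  · exact ⟨fun h => by simpa [kolFreq] using congrFun h 2, kolFreq_ne_chebFreq,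
      kolFreq_ne_neg_chebFreq⟩

/-- The shell is symmetric. [folklore] -/
theorem chebModes_symm : ∀ k ∈ chebModes, -k ∈ chebModes := by
  intro k hk
  rcases mem_chebModes_iff.1 hk with rfl | rfl | rfl | rfl <;> simp [mem_chebModes_iff]

/-- Shell modes have vanishing first component. [folklore] -/
theorem apply_zero_of_mem_chebModes {k : Fin 3 → ℤ} (hk : k ∈ chebModes) : k 0 = 0 := by
  rcases mem_chebModes_iff.1 hk with rfl | rfl | rfl | rfl <;> simp [kolFreq, chebFreq]

/-- Shell modes have vanishing second component. [folklore] -/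
theorem apply_one_of_mem_chebModes {k : Fin 3 → ℤ} (hk : k ∈ chebModes) : k 1 = 0 := by
  rcases mem_chebModes_iff.1 hk with rfl | rfl | rfl | rfl <;> simp [kolFreq, chebFreq]

/-! ### The multiplier `Ψ = (cos(2πx₃)/(3π) + cos(6πx₃)/(54π)) e₁` -/

/-- Amplitudes: `1/(3π)` on `±e₃`, `1/(54π)` elsewhere (only `±3e₃` is used). [folklore] -/
def chebAmp (n : ℤ) : ℝ := if n = 1 ∨ n = -1 then 1 / (3 * Real.pi) else 1 / (54 * Real.pi)

/-- The amplitude is even in the frequency. [folklore] -/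
theorem chebAmp_neg (n : ℤ) : chebAmp (-n) = chebAmp n := by
  unfold chebAmp
  congr 1
  simp only [neg_eq_iff_eq_neg, neg_neg, eq_iff_iff]
  tauto

/-- Amplitude at `k₃ = 1`. [folklore] -/
@[simp] theorem chebAmp_one : chebAmp 1 = 1 / (3 * Real.pi) := by simp [chebAmp]
/-- Amplitude at `k₃ = -1`. [folklore] -/
@[simp] theorem chebAmp_neg_one : chebAmp (-1) = 1 / (3 * Real.pi) := by simp [chebAmp]
/-- Amplitude at `k₃ = 3`. [folklore] -/
@[simp] theorem chebAmp_three : chebAmp 3 = 1 / (54 * Real.pi) := by norm_num [chebAmp]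
/-- Amplitude at `k₃ = -3`. [folklore] -/
@[simp] theorem chebAmp_neg_three : chebAmp (-3) = 1 / (54 * Real.pi) := by norm_num [chebAmp]

/-- Coefficients of the multiplier: `chebAmp(k₃) · ½e₁`. [folklore] -/
def chebCoeff (k : Fin 3 → ℤ) : EuclideanSpace ℂ (Fin 3) := (chebAmp (k 2) : ℂ) • kolVec

/-- The coefficients as real multiples of `½e₁`. [folklore] -/
theorem chebCoeff_eq_real_smul (k : Fin 3 → ℤ) : chebCoeff k = (chebAmp (k 2)) • kolVec := by
  rw [chebCoeff, Complex.coe_smul]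

/-- The coefficients are conjugate-symmetric (the multiplier is real). [folklore] -/
theorem isConjSymm_chebCoeff : IsConjSymm chebCoeff := fun k => by
  rw [chebCoeff_eq_real_smul, chebCoeff_eq_real_smul, EuclideanSpace.conjVec_real_smul,
    conjVec_kolVec, Pi.neg_apply, chebAmp_neg]

/-- The coefficients are transversal (the multiplier is divergence free). [folklore] -/
theorem isTransversal_chebCoeff : IsTransversal chebModes chebCoeff := fun k hk => by
  simp [Fin.sum_univ_three, chebCoeff, apply_zero_of_mem_chebModes hk, apply_one_of_mem_chebModes hk]

/-- **The two-mode Chebyshev multiplier** `Ψ = (cos(2πx₃)/(3π) + cos(6πx₃)/(54π)) e₁`. [folklore] -/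
def chebPsi : UnitAddTorus (Fin 3) → EuclideanSpace ℝ (Fin 3) := realTrigPoly chebModes chebCoeff

/-- `Ψ` is smooth. [folklore] -/
theorem isSmooth_chebPsi : IsSmooth chebPsi := isSmooth_realTrigPoly _ _

/-- `Ψ` is divergence free. [folklore] -/
theorem isDivFree_chebPsi : IsDivFree chebPsi := isDivFree_realTrigPoly isTransversal_chebCoeff

/-- Coefficients of `∂₃Ψ`. [folklore] -/
def chebDCoeff (k : Fin 3 → ℤ) : EuclideanSpace ℂ (Fin 3) :=
  (2 * Real.pi * Complex.I * ((k 2 : ℤ) : ℂ)) • chebCoeff k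

/-- `∂₃Ψ = −(⅔ sin 2πx₃ + ⅑ sin 6πx₃) e₁` as a real trigonometric polynomial. [folklore] -/
def chebDPsi : UnitAddTorus (Fin 3) → EuclideanSpace ℝ (Fin 3) := realTrigPoly chebModes chebDCoeff

/-- `∂₁Ψ = 0`. [folklore] -/
theorem partialDeriv_zero_chebPsi (y : UnitAddTorus (Fin 3)) : partialDeriv 0 chebPsi y = 0 := by
  rw [chebPsi, partialDeriv_realTrigPoly,
    realTrigPoly_congr (c' := 0) fun k hk => by
      rw [apply_zero_of_mem_chebModes hk, Int.cast_zero, mul_zero, zero_smul, Pi.zero_apply],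
    realTrigPoly_zero, Pi.zero_apply]

/-- `∂₂Ψ = 0`. [folklore] -/
theorem partialDeriv_one_chebPsi (y : UnitAddTorus (Fin 3)) : partialDeriv 1 chebPsi y = 0 := by
  rw [chebPsi, partialDeriv_realTrigPoly,
    realTrigPoly_congr (c' := 0) fun k hk => by
      rw [apply_one_of_mem_chebModes hk, Int.cast_zero, mul_zero, zero_smul, Pi.zero_apply],
    realTrigPoly_zero, Pi.zero_apply]

/-- `∂₃Ψ = chebDPsi`. [folklore] -/
theorem partialDeriv_two_chebPsi (y : UnitAddTorus (Fin 3)) :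
    partialDeriv 2 chebPsi y = chebDPsi y := by
  rw [chebPsi, partialDeriv_realTrigPoly]
  rfl

/-- Advection of `Ψ` by a constant field: `(v·∇)Ψ = v₃ ∂₃Ψ`. [folklore] -/
theorem convect_const_chebPsi (v : EuclideanSpace ℝ (Fin 3)) (y : UnitAddTorus (Fin 3)) :
    Torus.convect (fun _ => v) chebPsi y = (v 2) • chebDPsi y := by
  have h1 : IsContDiff 1 chebPsi := isSmooth_chebPsi.isContDiff (by simp)
  rw [Torus.convect, fderiv_apply_eq_sum_partialDeriv h1, Fin.sum_univ_three,
    partialDeriv_zero_chebPsi, partialDeriv_one_chebPsi, partialDeriv_two_chebPsi, smul_zero,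
    smul_zero, zero_add, zero_add]

/-- `(∂₃Ψ)₂ = 0`. [folklore] -/
theorem chebDPsi_apply_one (y : UnitAddTorus (Fin 3)) : chebDPsi y 1 = 0 := by
  rw [chebDPsi, realTrigPoly_apply_coord, trigPoly_apply_coord]
  simp [chebDCoeff, chebCoeff]

/-- `(∂₃Ψ)₃ = 0`. [folklore] -/
theorem chebDPsi_apply_two (y : UnitAddTorus (Fin 3)) : chebDPsi y 2 = 0 := by
  rw [chebDPsi, realTrigPoly_apply_coord, trigPoly_apply_coord]
  simp [chebDCoeff, chebCoeff]

/-- `⟪v, ∂₃Ψ(y)⟫ = v₁ (∂₃Ψ)₁(y)`. [folklore] -/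
theorem inner_chebDPsi_eq (v : EuclideanSpace ℝ (Fin 3)) (y : UnitAddTorus (Fin 3)) :
    ⟪v, chebDPsi y⟫_ℝ = v 0 * chebDPsi y 0 := by
  simp [PiLp.inner_apply, Fin.sum_univ_three, chebDPsi_apply_one, chebDPsi_apply_two, mul_comm]

/-! ### Pointwise evaluation through `e_{e₃}(y) = fourier 1 (y₃)` -/

/-- `e_{e₃}(y) = e^{2πi y₃}`. [folklore] -/
theorem mFourier_kolFreq (y : UnitAddTorus (Fin 3)) : mFourier kolFreq y = fourier 1 (y 2) := by
  rw [kolFreq_eq_single]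
  exact mFourier_single y 2

/-- `e_{-e₃}(y) = conj e^{2πi y₃}`. [folklore] -/
theorem mFourier_neg_kolFreq (y : UnitAddTorus (Fin 3)) :
    mFourier (-kolFreq) y = conj (fourier 1 (y 2) : ℂ) := by
  rw [mFourier_neg, mFourier_kolFreq]

/-- `e_{3e₃}(y) = (e^{2πi y₃})³`. [folklore] -/
theorem mFourier_chebFreq (y : UnitAddTorus (Fin 3)) :
    mFourier chebFreq y = (fourier 1 (y 2) : ℂ) ^ 3 := by
  rw [chebFreq_eq, mFourier_add, mFourier_add, mFourier_kolFreq]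
  ring

/-- `e_{-3e₃}(y) = (conj e^{2πi y₃})³`. [folklore] -/
theorem mFourier_neg_chebFreq (y : UnitAddTorus (Fin 3)) :
    mFourier (-chebFreq) y = (conj (fourier 1 (y 2) : ℂ)) ^ 3 := by
  rw [mFourier_neg, mFourier_chebFreq, map_pow]

/-- `|e^{2πi y₃}| = 1`. [folklore] -/
theorem norm_fourier_one_apply (y : UnitAddTorus (Fin 3)) : ‖(fourier 1 (y 2) : ℂ)‖ = 1 := by
  rw [fourier_apply]
  exact Circle.norm_coe _

/-- `cos² + sin² = 1` for `e^{2πi y₃}`. [folklore] -/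
theorem re_sq_add_im_sq_fourier (y : UnitAddTorus (Fin 3)) :
    (fourier 1 (y 2) : ℂ).re ^ 2 + (fourier 1 (y 2) : ℂ).im ^ 2 = 1 := by
  have h : Complex.normSq (fourier 1 (y 2) : ℂ) = 1 := by
    rw [← Complex.sq_norm, norm_fourier_one_apply, one_pow]
  rw [Complex.normSq_apply] at h
  nlinarith [h]

/-- First coefficient at `e₃`: `i/3`. [folklore] -/
theorem chebDCoeff_kolFreq_zero : chebDCoeff kolFreq 0 = ((1 / 3 : ℝ) : ℂ) * Complex.I := by
  simp only [chebDCoeff, chebCoeff, PiLp.smul_apply, smul_eq_mul, kolVec_apply_zero,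
    kolFreq_apply_two, chebAmp_one]
  push_cast
  field_simp
  try ring

/-- First coefficient at `-e₃`: `-i/3`. [folklore] -/
theorem chebDCoeff_neg_kolFreq_zero :
    chebDCoeff (-kolFreq) 0 = -(((1 / 3 : ℝ) : ℂ) * Complex.I) := by
  simp only [chebDCoeff, chebCoeff, PiLp.smul_apply, smul_eq_mul, kolVec_apply_zero, Pi.neg_apply,
    kolFreq_apply_two, chebAmp_neg_one]
  push_cast
  field_simp
  try ring

/-- First coefficient at `3e₃`: `i/18`. [folklore] -/
theorem chebDCoeff_chebFreq_zero : chebDCoeff chebFreq 0 = ((1 / 18 : ℝ) : ℂ) * Complex.I := by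
  simp only [chebDCoeff, chebCoeff, PiLp.smul_apply, smul_eq_mul, kolVec_apply_zero,
    chebFreq_apply_two, chebAmp_three]
  push_cast
  field_simp
  try ring

/-- First coefficient at `-3e₃`: `-i/18`. [folklore] -/
theorem chebDCoeff_neg_chebFreq_zero :
    chebDCoeff (-chebFreq) 0 = -(((1 / 18 : ℝ) : ℂ) * Complex.I) := by
  simp only [chebDCoeff, chebCoeff, PiLp.smul_apply, smul_eq_mul, kolVec_apply_zero, Pi.neg_apply,
    chebFreq_apply_two, chebAmp_neg_three]
  push_cast
  field_simp
  try ring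

/-- **Pointwise value of `(∂₃Ψ)₁`**: with `z = e^{2πi y₃}`,
`(∂₃Ψ)₁(y) = −(⅔ Im z + ⅑ Im z³) = −(⅔ Im z + ⅑ (3 (Re z)² Im z − (Im z)³))`. [folklore] -/
theorem chebDPsi_apply_zero (y : UnitAddTorus (Fin 3)) :
    chebDPsi y 0 = -(2 / 3 * (fourier 1 (y 2) : ℂ).im + 1 / 9 *
      (3 * (fourier 1 (y 2) : ℂ).re ^ 2 * (fourier 1 (y 2) : ℂ).im - (fourier 1 (y 2) : ℂ).im ^ 3)) := by
  rw [chebDPsi, realTrigPoly_apply_coord, trigPoly_apply_coord, sum_chebModes, mFourier_kolFreq,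
    mFourier_neg_kolFreq, mFourier_chebFreq, mFourier_neg_chebFreq, chebDCoeff_kolFreq_zero,
    chebDCoeff_neg_kolFreq_zero, chebDCoeff_chebFreq_zero, chebDCoeff_neg_chebFreq_zero]
  simp only [Complex.add_re, Complex.mul_re, Complex.mul_im, Complex.neg_re, Complex.neg_im,
    Complex.I_re, Complex.I_im, Complex.ofReal_re, Complex.ofReal_im, Complex.conj_re,
    Complex.conj_im, pow_succ, pow_zero, one_mul]
  ring

/-- **The Chebyshev bound** `3 (∂₃Ψ)₁² ≤ 1` pointwise:
`1 − 3p(s)² = (1 − s²/3)(1 − 4s²/3)² ≥ 0` for `s = sin 2πy₃ ∈ [−1,1]`. [folklore] -/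
theorem three_mul_sq_chebDPsi_le (y : UnitAddTorus (Fin 3)) : 3 * chebDPsi y 0 ^ 2 ≤ 1 := by
  rw [chebDPsi_apply_zero]
  set a := (fourier 1 (y 2) : ℂ).re
  set b := (fourier 1 (y 2) : ℂ).im
  have hab : a ^ 2 + b ^ 2 = 1 := re_sq_add_im_sq_fourier y
  have ha : a ^ 2 = 1 - b ^ 2 := by linarith
  have hb : b ^ 2 ≤ 1 := by nlinarith [sq_nonneg a]
  have key : 3 * (-(2 / 3 * b + 1 / 9 * (3 * a ^ 2 * b - b ^ 3))) ^ 2 =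
      1 - (1 - b ^ 2 / 3) * (1 - 4 * b ^ 2 / 3) ^ 2 := by
    rw [ha]; ring
  rw [key]
  nlinarith [mul_nonneg (show (0 : ℝ) ≤ 1 - b ^ 2 / 3 by linarith) (sq_nonneg (1 - 4 * b ^ 2 / 3))]

/-- **The semidefinite constant of the two-mode multiplier**: `v·(∇Ψ(y))v ≥ −(√3/6)|v|²` for all
`y ∈ 𝕋³`, `v ∈ ℝ³` (`(v·∇)Ψ = v₃ ∂₃Ψ`, `⟪v,∂₃Ψ⟫ = v₁(∂₃Ψ)₁`, `|(∂₃Ψ)₁| ≤ 1/√3`,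
`2|v₁v₃| ≤ v₁² + v₃²`). [folklore] -/
theorem semidefinite_chebPsi (y : UnitAddTorus (Fin 3)) (v : EuclideanSpace ℝ (Fin 3)) :
    -(Real.sqrt 3 / 6 * ‖v‖ ^ 2) ≤ ⟪v, Torus.convect (fun _ => v) chebPsi y⟫_ℝ := by
  have hv : ‖v‖ ^ 2 = v 0 ^ 2 + v 1 ^ 2 + v 2 ^ 2 := by
    rw [EuclideanSpace.norm_sq_eq, Fin.sum_univ_three]
    simp only [Real.norm_eq_abs, sq_abs]
  rw [convect_const_chebPsi, real_inner_smul_right, inner_chebDPsi_eq, hv]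
  set p := chebDPsi y 0 with hp_def
  have hp : 3 * p ^ 2 ≤ 1 := three_mul_sq_chebDPsi_le y
  set s := Real.sqrt 3 with hs_def
  have hs : s ^ 2 = 3 := Real.sq_sqrt (by norm_num)
  have hs0 : 0 < s := Real.sqrt_pos.2 (by norm_num)
  have hq : (s * p) ^ 2 ≤ 1 := by rw [mul_pow, hs]; linarith
  have key : -(1 / 2 * (v 0 ^ 2 + v 1 ^ 2 + v 2 ^ 2)) ≤ v 2 * (v 0 * (s * p)) := by
    nlinarith [sq_nonneg (v 0 + s * p * v 2), mul_nonneg (sq_nonneg (v 2)) (sub_nonneg.2 hq),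
      sq_nonneg (v 1)]
  have e1 : s * (-(s / 6 * (v 0 ^ 2 + v 1 ^ 2 + v 2 ^ 2))) =
      -(1 / 2 * (v 0 ^ 2 + v 1 ^ 2 + v 2 ^ 2)) := by
    linear_combination (-(1 / 6) * (v 0 ^ 2 + v 1 ^ 2 + v 2 ^ 2)) * hs
  have e2 : s * (v 2 * (v 0 * p)) = v 2 * (v 0 * (s * p)) := by ring
  have h : s * (-(s / 6 * (v 0 ^ 2 + v 1 ^ 2 + v 2 ^ 2))) ≤ s * (v 2 * (v 0 * p)) := by
    rw [e1, e2]; exact key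
  exact le_of_mul_le_mul_left h hs0

/-! ### The force pairing and the floor -/

/-- **Work of the force against the multiplier**: `∫⟪f,Ψ⟫ = 2 · (1/(3π)) · ¼ = 1/(6π)`. [folklore] -/
theorem integral_inner_kolForce_chebPsi : ∫ x, ⟪kolForce x, chebPsi x⟫_ℝ = 1 / (6 * Real.pi) := by
  rw [kolForce, chebPsi, integral_inner_realTrigPoly_right chebModes_symm isConjSymm_chebCoeff
    (memLp_realTrigPoly kolModes kolForceCoeff 2)]
  simp_rw [mFourierCoeff_realTrigPoly kolModes_symm isConjSymm_kolForceCoeff]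
  rw [sum_chebModes, if_pos kolFreq_mem, if_pos neg_kolFreq_mem, if_neg chebFreq_not_mem_kolModes,
    if_neg neg_chebFreq_not_mem_kolModes]
  simp only [inner_zero_left, Complex.zero_re, add_zero]
  rw [kolForceCoeff_of_ne_zero (ne_zero_of_mem_kolModes kolFreq_mem),
    kolForceCoeff_of_ne_zero (ne_zero_of_mem_kolModes neg_kolFreq_mem), chebCoeff, chebCoeff,
    inner_smul_right, inner_smul_right, inner_kolVec_self, Pi.neg_apply, kolFreq_apply_two,
    chebAmp_one, chebAmp_neg_one, ← Complex.ofReal_mul, Complex.ofReal_re]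
  field_simp
  norm_num

/-- **Energy floor under Kolmogorov forcing, two-mode Chebyshev multiplier.** Every
vanishing-viscosity family of global Leray–Hopf weak solutions of `NS_{νⱼ}(cos(2πx₃)e₁)` on `𝕋³`
(`νⱼ > 0`, `νⱼ → 0`, arbitrary data) whose mean energies are bounded by `E` has
`E ≥ 1/(π√3) ≈ 0.184` (the force: `Theorems/SoloBlindDriftStates.kolForce`; the one-mode floor
`1/(2π)` is `kolmogorov_energyBound_ge`; the sawtooth supremum `2/π²` is not attained by a smooth
multiplier). [cite: DoeringFoias2002, §3] [cite: DoeringEckhardtSchumacher2003, Lemma 2] -/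
theorem kolmogorov_energyBound_ge_chebyshev {ν : ℕ → ℝ}
    {u₀ : ℕ → UnitAddTorus (Fin 3) → EuclideanSpace ℝ (Fin 3)}
    {u : ℕ → ℝ → UnitAddTorus (Fin 3) → EuclideanSpace ℝ (Fin 3)} {E : ℝ}
    (hν : ∀ j, 0 < ν j) (hν₀ : Tendsto ν atTop (𝓝 0))
    (hu : ∀ j, Torus.IsGlobalLerayHopf (ν j) (fun _ => kolForce) (u₀ j) (u j))
    (hE : ∀ j, meanEnergy (u j) ≤ E) :
    1 / (Real.pi * Real.sqrt 3) ≤ E := by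
  have h := forcePairing_le_strain_mul_of_family hν hν₀ hu isSmooth_kolForce hasZeroMean_kolForce
    isSmooth_chebPsi isDivFree_chebPsi (by positivity : (0 : ℝ) ≤ Real.sqrt 3 / 6)
    semidefinite_chebPsi hE
  rw [integral_inner_kolForce_chebPsi] at h
  have hs : Real.sqrt 3 ^ 2 = 3 := Real.sq_sqrt (by norm_num)
  have hs0 : 0 < Real.sqrt 3 := Real.sqrt_pos.2 (by norm_num)
  have hπ := Real.pi_pos
  rw [div_le_iff₀ (by positivity)] at h ⊢
  -- `h : 1 ≤ √3/6 · E · (6π)`, goal `1 ≤ E · (π · √3)`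
  nlinarith [h]

/-- The same floor on the data of `Literature.Turb.ZerothLaw`: a would-be witness family of the
zeroth law built on the Kolmogorov force carries mean energy bound `E ≥ 1/(π√3)`. [folklore] -/
theorem kolmogorov_witness_energyBound_ge_chebyshev {ν : ℕ → ℝ}
    {u₀ : ℕ → UnitAddTorus (Fin 3) → EuclideanSpace ℝ (Fin 3)}
    {u : ℕ → ℝ → UnitAddTorus (Fin 3) → EuclideanSpace ℝ (Fin 3)}
    (hν : ∀ j, 0 < ν j) (hν₀ : Tendsto ν atTop (𝓝 0))
    (hu : ∀ j, Torus.IsGlobalLerayHopf (ν j) (fun _ => kolForce) (u₀ j) (u j))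
    (hE : ∃ E : ℝ, ∀ j, meanEnergy (u j) ≤ E) :
    ∃ E : ℝ, (∀ j, meanEnergy (u j) ≤ E) ∧
      ∀ E' : ℝ, (∀ j, meanEnergy (u j) ≤ E') → 1 / (Real.pi * Real.sqrt 3) ≤ E' := by
  obtain ⟨E, hE⟩ := hE
  exact ⟨E, hE, fun E' hE' => kolmogorov_energyBound_ge_chebyshev hν hν₀ hu hE'⟩

end Summit.AnomalousDissipation.AnomalousDissipation.Theorems
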